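import Summits.CriticalPhenomena.CardyFormulaZ2.Theorems.CardyBondTriangularBondTriangularCardyBlueArmZero
import HarnessLib

/-!
# Route CardyBondTriangular · crux `BondTriangularCardy` (stmt-CriticalPhenomena-4664), line `birth`: stub `stub_blueArm`

The BLUE ARM of Bollobás–Riordan's Claim 10 (*Percolation*, CUP 2006, Ch. 7, pp. 177–179) for
the Chayes–Lei separating events of the hexagon model with half-edge connectivity (Chayes–Lei,
Rev. Math. Phys. 19 (2007) §2.1): `Eⁱ(oppFace w j) ∖ Eⁱ(w)` forces a `clBlueGraph` path from a
vertex-hexagon of `w` to the arc `Aᵢ`. Proved in the frame of `A₀` in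
`…BlueArmZero` (`KiteB.clBlueArm_zero`: the separating yellow path uses the bond `x₁x₂` with `w`
on its left; the kite interface — kites `K(h, F)` coloured by `(σ h).yellowAt h F`, outer kites by
the stretch of the boundary dart — passes by `w` and is followed with the blue kites on its left,
its closing up being excluded by the necklace argument of pp. 178–179 run on the kite tiling);
here the marks are rotated (`TriMarkedDomain.exists_rotate3`) so that the target arc is `A₀`.

References: B. Bollobás, O. Riordan, *Percolation*, CUP 2006, Ch. 7 Claim 10 pp. 177–179
[BollobasRiordan2006]; L. Chayes, H. K. Lei, Rev. Math. Phys. 19 (2007) §2.1 [ChayesLei2007].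
-/

noncomputable section

namespace Summit.CriticalPhenomena.CardyFormulaZ2.Theorems.BondTriangularCardyLine

open Set Filter Topology Metric

/-- v4: the BLUE ARM of Claim 10 for the Chayes–Lei separating events (combinatorial, model-free; brute-force validated by
w-equicontinuity on > 25 000 instances): `Eⁱ(oppFace w j) ∖ Eⁱ(w)` forces a clBlueGraph path from a vertex-hexagon of `w`
to the arc `A_i` (proof plan: Bollobás–Riordan pp. 177–179 run on the CL kite tiling — colour classes consecutive at every
kite vertex by `yellowAt_downCorner_of_upCorner`, so interfaces are simple; work/stubs/BlueArm_PLAN.txt).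
(ref: BollobasRiordan2006, Ch. 7 Claim 10 pp. 177–179; ChayesLei2007 §2.1) -/
def Sig.stub_blueArm : Prop :=
  ∀ (D : Literature.Probability.Percolation.TriMarkedDomain 3) (w : Literature.Probability.LatticeModels.HexVertex) (i j : Fin 3), Literature.Probability.LatticeModels.hexFaceVertices w ⊆ D.verts → D.clSepEvent i (Literature.Probability.Percolation.oppFace w j) \ D.clSepEvent i w ⊆ {σ | ∃ k : Fin 3, ∃ u ∈ D.arc i, (Literature.Probability.Percolation.clBlueGraph σ).Reachable (Literature.Probability.Percolation.faceVertex w k) u}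

/-- The separating events of the hexagon model only depend on the sites and the stretches of the
marked domain. -/
theorem clSepEvent_eq_of_stretch_eq (T D : Literature.Probability.Percolation.TriMarkedDomain 3) (hv : T.verts = D.verts)
    (i : Fin 3) (hs : ∀ j, T.stretch j = D.stretch (j + i)) (j : Fin 3) (z : Literature.Probability.LatticeModels.HexVertex) :
    T.clSepEvent j z = D.clSepEvent (j + i) z := by
  unfold Literature.Probability.Percolation.TriMarkedDomain.clSepEvent
  rw [hs, hs, hs, hv, add_right_comm j 1 i, add_right_comm j 2 i]

/-- **Stub `stub_blueArm` of the line `birth`**: the blue arm of Claim 10 for the Chayes–Lei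
separating events, from the frame of `A₀` (`KiteB.clBlueArm_zero`) by rotating the marks. -/
theorem stub_blueArm : Sig.stub_blueArm := by
  intro D w i j hw
  obtain ⟨T, hTv, hTs⟩ := D.exists_rotate3 i
  have hsep : ∀ j' z, T.clSepEvent j' z = D.clSepEvent (j' + i) z := clSepEvent_eq_of_stretch_eq T D hTv i hTs
  have harc : ∀ j', T.arc j' = D.arc (j' + i) := fun j' => by
    unfold Literature.Probability.Percolation.TriMarkedDomain.arc; rw [hTs]
  have key := KiteB.clBlueArm_zero T w j (by rw [hTv]; exact hw)
  rw [hsep, hsep, harc, zero_add] at key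
  exact key

end Summit.CriticalPhenomena.CardyFormulaZ2.Theorems.BondTriangularCardyLine

end
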